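import Literature.Computability.Cryptography.ChenQuantumLWEProductState
import Literature.NumberTheory.GaussSums.QuadraticGaussSumOddModulus
import Mathlib.Data.Nat.ChineseRemainder
import Mathlib.Tactic.LinearCombination

/-!
# `|φ8.f⟩` is a product state for EVERY admissible shape — proofs of the `ChenQuantumLWEProductState` statements

REPRODUCTION / ANALYSIS OF A CLAIMED RESULT UNDER ADJUDICATION (withdrawn): Yilei Chen, *Quantum
Algorithms for Lattice Problems*, IACR ePrint 2024/555, version of 2024-04-18 [ChenQuantumLattice2024],
Step 9 (§3.5.9, pp. 34–38, eq. (40)); see `ChenQuantumLWESteps.lean` for the author's withdrawal notes.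
Bundle `papers/QuantumAdvantage/lwe-quantum-autopsy/` (Part 1), companion of `STEPS.md` §4.4.
HONEST FRAMING: kernel-checked THEOREMS about the state produced by Steps 8–9(d) of a WITHDRAWN
algorithm — a precise negative result, NOT summit progress, no cryptanalytic claim in either direction.

Contents.
* `e_val_div_eq_stdAddChar`, `e_intCast_div_eq_stdAddChar`, `e_val_add` — the paper's phase
  `e(t/N) = exp(2πi t/N)` IS Mathlib's standard additive character `ZMod.stdAddChar`; hence additive in
  the residue.  `gaussSumModulus_holds` — `GaussSumModulus m a b` for every `m, a, b`, from
  `Literature.NumberTheory.GaussSums.norm_sq_sum_stdAddChar_quadratic` (Korobov 1992, Ch. I §3).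
* `certificateGivesProduct_holds` — every CRT-certified chirped line is a product state
  (coordinate 0) ⊗ (coordinates 1..n) (CRT reindexing through `Nat.chineseRemainder`).
* `phi8fCertificate` — the certificate EXISTS for every shape with `gcd(p₁,Q) = 1`, `Q ∣ b*₀`,
  `p₁ ∣ b*ᵢ (i ≥ 1)` (Chen's eq. (39): `b*₀ = Q`, `b*ᵢ ∈ 2p₁ℤ`), with NO condition on the offsets `v*`:
  `θ₁(j₁) = -αQ·j₁²`, `θ₂(j₂) = -βp₁·j₂²` from a Bézout pair `αQ + βp₁ = 1` (`Nat.gcdB`, `Nat.gcdA`).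
* `phi8fLine_isProduct` — hence Chen's `|φ8.f⟩` (`phi8fLine`) is a product state, and
  `Shape.phi8f_isProduct` — the same for the `Steps` rendering of eq. (40) (`Shape.phi8f`, indexed by
  `j ∈ [0,P)` exactly as printed), for every `Admissible` shape, via `Shape.phi8f_eq_ket`.
* `localMapsPreserveProduct_holds` — any linear map on the first tensor factor keeps product states
  product (§4.4(b)): so no replacement of Chen's operations (9.e)–(9.g) acting on coordinate 0 alone can
  produce the displayed, correlated `|φ8.i⟩`; `phi8fLine_processed_isProduct` spells this out.

What is NOT here: the QFT consequences (`u[1..n]` exactly uniform and independent of `u₀`;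
`Pr[eq. (41)] = 1/Q`) are derived in `STEPS.md` §4.4(c)(d) / `REPAIR-CENSUS.md` T2 of the bundle from
`gaussSumModulus_holds` and the product structure, and verified exactly on toy instances
(`numerics/step9_exact/`, `numerics/b2b-lwe-2/`), but not formalised in this file.  An independent Lean
proof of the first three items (with `b*₀ = Q`, `v*₀ = 0`) exists in the bundle's package module
`LweAutopsy/ProductStateProofs.lean` (Part 4).
-/

namespace Literature.Computability.Cryptography.Chen2024

open scoped BigOperators

/-! ### The phase `e` is the standard additive character -/

/-- The paper's phase at a residue, `e(t.val / N)`, is the standard additive character of `ZMod N`.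
[folklore] -/
theorem e_val_div_eq_stdAddChar (N : ℕ) [NeZero N] (t : ZMod N) :
    e ((t.val : ℚ) / N) = ZMod.stdAddChar t := by
  rw [ZMod.stdAddChar_apply, ZMod.toCircle_apply, e]
  congr 1
  push_cast
  ring

/-- Same for an integer representative: `e(k / N) = stdAddChar (k mod N)`. [folklore] -/
theorem e_intCast_div_eq_stdAddChar (N : ℕ) [NeZero N] (k : ℤ) :
    e ((k : ℚ) / N) = ZMod.stdAddChar (k : ZMod N) := by
  rw [ZMod.stdAddChar_coe, e]
  congr 1
  push_cast
  ring

/-- Additivity of the phase in the residue: `e((s+t).val/N) = e(s.val/N) · e(t.val/N)`. [folklore] -/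
theorem e_val_add (N : ℕ) [NeZero N] (s t : ZMod N) :
    e (((s + t).val : ℚ) / N) = e ((s.val : ℚ) / N) * e ((t.val : ℚ) / N) := by
  simp only [e_val_div_eq_stdAddChar, AddChar.map_add_eq_mul]

/-- `GaussSumModulus m a b` (`STEPS.md` §4.4(c)) holds for every odd `m`, unit `a`, any `b`: the
quadratic Gauss sum with odd denominator has modulus `√m` (Korobov 1992, Ch. I §3, Thm 3 / eq. (41)).
[cite: Korobov1992, Ch. I §3 Thm 3, eq. (41)] -/
theorem gaussSumModulus_holds (m : ℕ) [NeZero m] (a b : ZMod m) : GaussSumModulus m a b := by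
  intro hm ha
  have hx : ∀ x : ZMod m,
      e (((a * x ^ 2 + b * x).val : ℚ) / m) = ZMod.stdAddChar (a * x ^ 2 + b * x) :=
    fun x => e_val_div_eq_stdAddChar m _
  simp_rw [hx]
  exact Literature.NumberTheory.GaussSums.norm_sq_sum_stdAddChar_quadratic m hm a b ha

/-! ### CRT certificates give product states -/


/-- `Fin.cons x y = v ↔ x = v 0 ∧ y = (v ∘ succ)`. [folklore] -/
theorem cons_eq_iff {n : ℕ} {α : Type*} (x : α) (y : Fin n → α) (v : Fin (n + 1) → α) :
    (Fin.cons x y : Fin (n + 1) → α) = v ↔ x = v 0 ∧ y = fun t => v (Fin.succ t) := by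
  constructor
  · intro h
    subst h
    refine ⟨?_, ?_⟩
    · simp
    · funext t
      simp
  · rintro ⟨h1, h2⟩
    subst h1 h2
    exact Fin.cons_self_tail v

/-- Integer casts into `ZMod N` agree when the difference is `N` times something. [folklore] -/
theorem intCast_eq_of_sub_eq_mul {N : ℕ} (a b k : ℤ) (h : b - a = (N : ℤ) * k) :
    (a : ZMod N) = (b : ZMod N) :=
  (ZMod.intCast_eq_intCast_iff_dvd_sub a b N).2 ⟨k, h⟩

/-- Bézout for a coprime pair, in the orientation used below: `gcdB·Q + gcdA·p₁ = 1`. [folklore] -/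
theorem bezout_of_coprime {p₁ Q : ℕ} (h : Nat.Coprime p₁ Q) :
    (Nat.gcdB p₁ Q : ℤ) * Q + (Nat.gcdA p₁ Q : ℤ) * p₁ = 1 := by
  have hg := Nat.gcd_eq_gcd_ab p₁ Q
  rw [Nat.Coprime.gcd_eq_one h] at hg
  push_cast at hg
  linear_combination (-1 : ℤ) * hg

/-- **§4.4(a), general.**  A CRT-certified chirped line is a product state across
(coordinate 0) ⊗ (coordinates 1..n): reindex `Σ_{j ∈ ℤ_P}` through `j ↦ (j mod p₁, j mod Q)`, a bijection onto
`[0,p₁) × [0,Q)` by the Chinese remainder theorem (`Nat.chineseRemainder`), and split the phase with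
`e_val_add`. [cite: ChenQuantumLattice2024, eq. (40) p. 36 and the author's note p. 37] -/
theorem certificateGivesProduct_holds {n : ℕ} (L : ChirpedLine n) (p₁ Q : ℕ) :
    CertificateGivesProduct L p₁ Q := by
  rintro ⟨C⟩
  classical
  have hP : (L.P : ℕ) = p₁ * Q := C.hP
  have hp₁ : p₁ ≠ 0 := by
    intro h; have := L.P.pos; rw [hP, h, zero_mul] at this; exact lt_irrefl 0 this
  have hQ : Q ≠ 0 := by
    intro h; have := L.P.pos; rw [hP, h, mul_zero] at this; exact lt_irrefl 0 this
  haveI : NeZero (L.P : ℕ) := ⟨L.P.ne_zero⟩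
  -- the two factors
  let F : ℕ → ZMod L.N → ℂ := fun k₁ x =>
    if x = C.A k₁ then e (((C.θ₁ k₁).val : ℚ) / L.P) else 0
  let G : ℕ → (Fin n → ZMod L.N) → ℂ := fun k₂ y =>
    if y = C.B k₂ then e (((C.θ₂ k₂).val : ℚ) / L.P) else 0
  refine ⟨fun x => ∑ k₁ ∈ Finset.range p₁, F k₁ x, fun y => ∑ k₂ ∈ Finset.range Q, G k₂ y,
    fun x y => ?_⟩
  have rhs : (∑ k₁ ∈ Finset.range p₁, F k₁ x) * (∑ k₂ ∈ Finset.range Q, G k₂ y)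
      = ∑ kk ∈ Finset.range p₁ ×ˢ Finset.range Q, F kk.1 x * G kk.2 y := by
    rw [Finset.sum_product, Finset.sum_mul_sum]
  rw [rhs]
  show L.ket (Fin.cons x y) = _
  unfold ChirpedLine.ket
  refine Finset.sum_nbij' (fun j : ZMod L.P => (j.val % p₁, j.val % Q))
    (fun kk => ((Nat.chineseRemainder C.cop kk.1 kk.2 : ℕ) : ZMod L.P)) ?_ ?_ ?_ ?_ ?_
  · intro j _
    simp only [Finset.mem_product, Finset.mem_range]
    exact ⟨Nat.mod_lt _ (Nat.pos_of_ne_zero hp₁), Nat.mod_lt _ (Nat.pos_of_ne_zero hQ)⟩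
  · intro kk _
    exact Finset.mem_univ _
  · intro j _
    have h := Nat.chineseRemainder_modEq_unique C.cop
      (Nat.mod_modEq j.val p₁).symm (Nat.mod_modEq j.val Q).symm
    rw [← hP] at h
    dsimp only
    rw [← (ZMod.natCast_eq_natCast_iff _ _ _).2 h, ZMod.natCast_zmod_val]
  · rintro ⟨k₁, k₂⟩ hk
    simp only [Finset.mem_product, Finset.mem_range] at hk
    have hlt : (Nat.chineseRemainder C.cop k₁ k₂ : ℕ) < L.P := by
      rw [hP]; exact Nat.chineseRemainder_lt_mul C.cop k₁ k₂ hp₁ hQ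
    have hval : ((Nat.chineseRemainder C.cop k₁ k₂ : ℕ) : ZMod L.P).val
        = (Nat.chineseRemainder C.cop k₁ k₂ : ℕ) := ZMod.val_cast_of_lt hlt
    simp only [hval, Prod.mk.injEq]
    exact ⟨Eq.trans ((Nat.chineseRemainder C.cop k₁ k₂).prop.1 :
              (Nat.chineseRemainder C.cop k₁ k₂ : ℕ) % p₁ = k₁ % p₁) (Nat.mod_eq_of_lt hk.1),
           Eq.trans ((Nat.chineseRemainder C.cop k₁ k₂).prop.2 :
              (Nat.chineseRemainder C.cop k₁ k₂ : ℕ) % Q = k₂ % Q) (Nat.mod_eq_of_lt hk.2)⟩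
  · intro j _
    simp only [F, G, cons_eq_iff, C.head j, C.tail j, C.phase j, e_val_add]
    by_cases h1 : x = C.A (j.val % p₁) <;> by_cases h2 : y = C.B (j.val % Q) <;> simp [h1, h2]

/-- Reduction of an affine register content modulo `N`: if `N ∣ 2d²·s·p` then
`2d²·v·s + w ≡ 2d²·(v mod p)·s + w (mod N)` — the coordinate reads `v mod p` only. [folklore] -/
theorem affine_cast_mod (N p : ℕ) (d s w : ℤ) (v : ℕ) (h : (N : ℤ) ∣ 2 * d ^ 2 * s * p) :
    ((2 * d ^ 2 * (v : ℤ) * s + w : ℤ) : ZMod N)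
      = ((2 * d ^ 2 * ((v % p : ℕ) : ℤ) * s + w : ℤ) : ZMod N) := by
  obtain ⟨c, hc⟩ := h
  have hdiv : ((v : ℕ) : ℤ) = ((v % p : ℕ) : ℤ) + (p : ℤ) * ((v / p : ℕ) : ℤ) := by
    exact_mod_cast (Nat.mod_add_div v p).symm
  refine intCast_eq_of_sub_eq_mul _ _ (-(c * ((v / p : ℕ) : ℤ))) ?_
  linear_combination (-((v / p : ℕ) : ℤ)) * hc + (-2 * d ^ 2 * s) * hdiv

/-- The CRT splitting of the chirp exponent: with a Bézout pair `αQ + βp₁ = 1`,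
`-j² ≡ -αQ·(j mod p₁)² - βp₁·(j mod Q)² (mod P)`, `P = p₁Q`. [folklore] -/
theorem neg_sq_crt_split {P : ℕ} [NeZero P] (p₁ Q : ℕ) (hP : P = p₁ * Q) (α β : ℤ)
    (hb : α * Q + β * p₁ = 1) (j : ZMod P) :
    -(j ^ 2) = ((-(α * Q * ((j.val % p₁ : ℕ) : ℤ) ^ 2) : ℤ) : ZMod P)
             + ((-(β * p₁ * ((j.val % Q : ℕ) : ℤ) ^ 2) : ℤ) : ZMod P) := by
  have h1 : ((j.val : ℕ) : ℤ) = ((j.val % p₁ : ℕ) : ℤ) + (p₁ : ℤ) * ((j.val / p₁ : ℕ) : ℤ) := by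
    exact_mod_cast (Nat.mod_add_div j.val p₁).symm
  have h2 : ((j.val : ℕ) : ℤ) = ((j.val % Q : ℕ) : ℤ) + (Q : ℤ) * ((j.val / Q : ℕ) : ℤ) := by
    exact_mod_cast (Nat.mod_add_div j.val Q).symm
  have hj : -(j ^ 2) = (((-(((j.val : ℕ) : ℤ) ^ 2)) : ℤ) : ZMod P) := by
    rw [Int.cast_neg, Int.cast_pow, Int.cast_natCast, ZMod.natCast_zmod_val]
  have hPZ : (P : ℤ) = (p₁ : ℤ) * (Q : ℤ) := by exact_mod_cast hP
  rw [hj, ← Int.cast_add]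
  refine intCast_eq_of_sub_eq_mul _ _
    (α * ((j.val / p₁ : ℕ) : ℤ) * (((j.val : ℕ) : ℤ) + ((j.val % p₁ : ℕ) : ℤ))
      + β * ((j.val / Q : ℕ) : ℤ) * (((j.val : ℕ) : ℤ) + ((j.val % Q : ℕ) : ℤ))) ?_
  linear_combination (-((j.val : ℕ) : ℤ) ^ 2) * hb
    + (α * Q * (((j.val : ℕ) : ℤ) + ((j.val % p₁ : ℕ) : ℤ))) * h1
    + (β * p₁ * (((j.val : ℕ) : ℤ) + ((j.val % Q : ℕ) : ℤ))) * h2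
    + (-(α * ((j.val / p₁ : ℕ) : ℤ) * (((j.val : ℕ) : ℤ) + ((j.val % p₁ : ℕ) : ℤ))
      + β * ((j.val / Q : ℕ) : ℤ) * (((j.val : ℕ) : ℤ) + ((j.val % Q : ℕ) : ℤ)))) * hPZ

/-- **The certificate exists for every shape** (STEPS.md §4.4(a); Chen eq. (39)–(40)): moduli
`P = p₁Q` with `gcd(p₁,Q)=1`, `N = D²P`; first coordinate slope `b*₀ ∈ Qℤ`, other slopes `b*ᵢ ∈ p₁ℤ`;
offsets `v*` arbitrary.  Coordinate 0 reads `j mod p₁`, coordinates `1..n` read `j mod Q`, and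
`-j² ≡ -αQ·(j mod p₁)² - βp₁·(j mod Q)² (mod P)` for the Bézout pair `αQ + βp₁ = 1`
(`α = Nat.gcdB p₁ Q`, `β = Nat.gcdA p₁ Q`). [cite: ChenQuantumLattice2024, eq. (39)–(40) p. 36] -/
noncomputable def phi8fCertificate (n : ℕ) (D p₁ Q : ℕ+) (bstar vstar : Fin (n + 1) → ℤ)
    (cop : Nat.Coprime p₁ Q) (hhead : (Q : ℤ) ∣ bstar 0)
    (htail : ∀ i, i ≠ 0 → (p₁ : ℤ) ∣ bstar i) :
    Certificate (phi8fLine n D p₁ Q bstar vstar) p₁ Q where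
  hP := rfl
  cop := cop
  A := fun k => ((2 * (D : ℤ) ^ 2 * ((k : ℕ) : ℤ) * bstar 0 + vstar 0 : ℤ) : ZMod _)
  B := fun k t =>
    ((2 * (D : ℤ) ^ 2 * ((k : ℕ) : ℤ) * bstar (Fin.succ t) + vstar (Fin.succ t) : ℤ) : ZMod _)
  θ₁ := fun k => ((-((Nat.gcdB p₁ Q : ℤ) * Q * ((k : ℕ) : ℤ) ^ 2) : ℤ) : ZMod _)
  θ₂ := fun k => ((-((Nat.gcdA p₁ Q : ℤ) * p₁ * ((k : ℕ) : ℤ) ^ 2) : ℤ) : ZMod _)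
  head := by
    intro j
    obtain ⟨c, hc⟩ := hhead
    have hd : ((((D * D * (p₁ * Q) : ℕ+) : ℕ) : ℤ)) ∣ 2 * (D : ℤ) ^ 2 * bstar 0 * (p₁ : ℕ) :=
      ⟨2 * c, by rw [hc]; push_cast; ring⟩
    exact affine_cast_mod _ p₁ (D : ℤ) (bstar 0) (vstar 0) j.val hd
  tail := by
    intro j
    funext t
    obtain ⟨c, hc⟩ := htail (Fin.succ t) (Fin.succ_ne_zero t)
    have hd : ((((D * D * (p₁ * Q) : ℕ+) : ℕ) : ℤ))
        ∣ 2 * (D : ℤ) ^ 2 * bstar (Fin.succ t) * (Q : ℕ) :=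
      ⟨2 * c, by rw [hc]; push_cast; ring⟩
    exact affine_cast_mod _ Q (D : ℤ) (bstar (Fin.succ t)) (vstar (Fin.succ t)) j.val hd
  phase := by
    intro j
    exact neg_sq_crt_split (P := ((p₁ * Q : ℕ+) : ℕ)) p₁ Q rfl _ _ (bezout_of_coprime cop) j

/-- **Chen's `|φ8.f⟩` is a product state** (coordinate 0) ⊗ (coordinates 1..n), for every shape with
`gcd(p₁,Q)=1`, `Q ∣ b*₀`, `p₁ ∣ b*ᵢ (i ≥ 1)` — in particular for every admissible instance of eq. (40); this is the
structural content of the author's note p. 37 ("the amplitude of `|φ8.f⟩` does not satisfy `M/2`-periodicity":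
coordinate 0 is a function of `j mod p₁` ONLY). [cite: ChenQuantumLattice2024, eq. (40) p. 36 and the author's note p. 37] -/
theorem phi8fLine_isProduct (n : ℕ) (D p₁ Q : ℕ+) (bstar vstar : Fin (n + 1) → ℤ)
    (cop : Nat.Coprime p₁ Q) (hhead : (Q : ℤ) ∣ bstar 0)
    (htail : ∀ i, i ≠ 0 → (p₁ : ℤ) ∣ bstar i) :
    IsProduct (splitFirst (phi8fLine n D p₁ Q bstar vstar).ket) :=
  certificateGivesProduct_holds _ p₁ Q ⟨phi8fCertificate n D p₁ Q bstar vstar cop hhead htail⟩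

/-- **§4.4(b), general.**  A linear map (kernel `K`) applied to the first tensor factor keeps
product states product. [folklore] -/
theorem localMapsPreserveProduct_holds (α α' β : Type) [Fintype α] :
    LocalMapsPreserveProduct α α' β := by
  rintro K ψ ⟨a, b, h⟩
  refine ⟨fun x' => ∑ x, K x' x * a x, b, fun x' y => ?_⟩
  simp only [h, Finset.sum_mul]
  refine Finset.sum_congr rfl fun x _ => ?_
  ring

/-- Corollary (§4.4(b) applied to (a)): whatever linear processing `K` (unitaries, added-and-discarded
ancillas, measurement branches) is applied to coordinate 0 of `|φ8.f⟩`, the result is still a product state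
— it can never be the displayed `|φ8.i⟩` (p. 37), whose coordinate 0 is correlated with the rest.
[cite: ChenQuantumLattice2024, §3.5.9 pp. 37–38] -/
theorem phi8fLine_processed_isProduct (n : ℕ) (D p₁ Q : ℕ+) (bstar vstar : Fin (n + 1) → ℤ)
    (cop : Nat.Coprime p₁ Q) (hhead : (Q : ℤ) ∣ bstar 0)
    (htail : ∀ i, i ≠ 0 → (p₁ : ℤ) ∣ bstar i)
    (α' : Type) (K : α' → ZMod (phi8fLine n D p₁ Q bstar vstar).N → ℂ) :
    IsProduct (fun z : α' × (Fin n → ZMod (phi8fLine n D p₁ Q bstar vstar).N) =>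
      ∑ x, K z.1 x * splitFirst (phi8fLine n D p₁ Q bstar vstar).ket (x, z.2)) :=
  localMapsPreserveProduct_holds _ _ _ K _ (phi8fLine_isProduct n D p₁ Q bstar vstar cop hhead htail)

end Literature.Computability.Cryptography.Chen2024

/-! ### The `Steps` rendering of eq. (40) is the same state -/

namespace Literature.Computability.Cryptography.Chen2024.Shape

open scoped BigOperators

variable (S : Shape)

/-- The chirped line (`ChirpedLine`) carrying the data of a `Shape`: Chen's `|φ8.f⟩`, eq. (40).
[cite: ChenQuantumLattice2024, eq. (40) p. 36] -/
def chirped : ChirpedLine S.n :=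
  phi8fLine S.n S.D S.p₁ S.Q S.bstar S.vstar

/-- The `Steps` ket `Shape.phi8f` (sum over `j ∈ [0,P)`, phase `e(-j²/P)`, eq. (40) as printed) equals the
ket of `S.chirped` (sum over `j ∈ ZMod P`, phase exponent `-j² ∈ ZMod P`).
[cite: ChenQuantumLattice2024, eq. (40) p. 36] -/
theorem phi8f_eq_ket : S.phi8f = S.chirped.ket := by
  funext z
  show (∑ j ∈ Finset.range (S.P : ℕ), if z = S.pt8f j then e (-((j : ℚ) ^ 2) / S.P) else 0)
    = ∑ j : ZMod ((S.p₁ * S.Q : ℕ+) : ℕ),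
        if z = S.pt8f j.val then
          e ((((-(j ^ 2) : ZMod ((S.p₁ * S.Q : ℕ+) : ℕ))).val : ℚ) / ((S.p₁ * S.Q : ℕ+) : ℕ))
        else 0
  symm
  refine Finset.sum_nbij' (fun j => j.val) (fun q => (q : ZMod ((S.p₁ * S.Q : ℕ+) : ℕ)))
    (fun j _ => ?_) (fun q _ => Finset.mem_univ _) (fun j _ => ?_) (fun q hq => ?_) (fun j _ => ?_)
  · exact Finset.mem_range.2 (ZMod.val_lt j)
  · exact ZMod.natCast_zmod_val j
  · exact ZMod.val_cast_of_lt (Finset.mem_range.1 hq)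
  · have hphase : e ((((-(j ^ 2) : ZMod ((S.p₁ * S.Q : ℕ+) : ℕ))).val : ℚ)
            / ((S.p₁ * S.Q : ℕ+) : ℕ)) = e (-((j.val : ℚ) ^ 2) / S.P) := by
      rw [e_val_div_eq_stdAddChar]
      have hq : (-((j.val : ℚ) ^ 2) / ((S.P : ℕ) : ℚ))
          = (((-(((j.val : ℕ) : ℤ) ^ 2) : ℤ) : ℚ) / (((S.p₁ * S.Q : ℕ+) : ℕ) : ℚ)) := by
        rw [show (S.P : ℕ) = ((S.p₁ * S.Q : ℕ+) : ℕ) from rfl]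
        push_cast
        ring
      rw [hq, e_intCast_div_eq_stdAddChar]
      congr 1
      rw [Int.cast_neg, Int.cast_pow, Int.cast_natCast, ZMod.natCast_zmod_val]
    rw [hphase]

/-- **Eq. (40) is a product state, for every admissible shape** (`STEPS.md` §4.4(a)):
`|φ8.f⟩ = |A⟩ ⊗ |B⟩` across coordinate 0 and coordinates 1..n.  Consequently (with
`localMapsPreserveProduct_holds`) no processing of coordinate 0 alone — Chen's (9.e)–(9.g) or any
replacement — yields a state in which coordinate 0 is correlated with the rest, such as the displayed
`|φ8.i⟩`. [cite: ChenQuantumLattice2024, eq. (40) p. 36 and the author's note p. 37] -/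
theorem phi8f_isProduct (h : S.Admissible) : IsProduct (splitFirst S.phi8f) := by
  rw [phi8f_eq_ket]
  exact phi8fLine_isProduct S.n S.D S.p₁ S.Q S.bstar S.vstar h.cop_pQ
    (by rw [h.bstar_head]) h.bstar_tail

end Literature.Computability.Cryptography.Chen2024.Shape
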